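import Mathlib.Analysis.InnerProductSpace.Calculus
import Mathlib.Analysis.InnerProductSpace.PiL2
import Mathlib.Analysis.Calculus.Deriv.Inv
import Mathlib.Analysis.Calculus.MeanValue
import Mathlib.Analysis.SpecialFunctions.Integrals.Basic
import Mathlib.MeasureTheory.Constructions.HaarToSphere
import Mathlib.MeasureTheory.Measure.Lebesgue.VolumeOfBalls
import Mathlib.MeasureTheory.Measure.Lebesgue.EqHaar
import HarnessLib

/-!
# Radial capacitor potentials of annuli in `ℝ⁴` and their staircase sums

Topic `Literature/Analysis/FunctionSpaces`. Elementary building blocks for DISCRETISED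
symmetrisation arguments in dimension four (the model space of the sharp log-Sobolev inequality
`Literature.Geometry.Riemannian.sharpLogSobolevAVR_four`): for radii `0 < a < b` the **capacitor
potential of the annulus `a < |x| < b`** is the radial function equal to `1` on `|x| ≤ a`, to `0` on
`|x| ≥ b` and harmonic in between, `x ↦ (|x|⁻² − b⁻²)/(a⁻² − b⁻²)` (the fundamental solution of
`ℝ⁴` is `|x|⁻²`); it minimises the Dirichlet energy among radial (indeed all) functions with these
boundary values, and its energy is `4π²/(a⁻² − b⁻²) = 2π² · 2/(a⁻² − b⁻²)` (Pólya–Szegő 1951,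
*Isoperimetric inequalities in mathematical physics*, §1.11–1.12, capacity of a spherical
condenser; here only the explicit formulas are needed, not the minimality).

* `annulusCapD a b = a⁻² − b⁻²`, `annulusCapProfile a b : ℝ → ℝ` (the profile, clamped: constant
  outside `[a, b]`), `annulusCap a b : ℝ⁴ → ℝ` (the radial function);
* `lipschitzWith_annulusCapProfile`, `lipschitzWith_annulusCap`; values (`= 1` inside, `= 0`
  outside, in `[0,1]`);
* `hasFDerivAt_annulusCap_of_mem` and `norm_fderiv_annulusCap`: off the two spheres the function
  is differentiable with `‖D(annulusCap a b)(x)‖ = 𝟙_{a<|x|<b} · 2/((a⁻² − b⁻²)|x|³)`;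
* `stairFun N R c = ∑_{j<N} c_j · annulusCap (R (j+1)) (R j)` for decreasing radii — Lipschitz,
  supported in `B̄(0, R 0)`, with values between consecutive partial sums of `c` on the annuli, and
  **energy identity** `integral_norm_fderiv_stairFun_sq`:
  `∫ ‖D(stairFun)‖² dx = ∑_{j<N} 4π² c_j²/(R(j+1)⁻² − R(j)⁻²)` (polar coordinates,
  `MeasureTheory.integral_fun_norm_addHaar`, `|B₁| = π²/2`).

Everything is proved; two definitions of functions, no named facts.

## References

* G. Pólya, G. Szegő, *Isoperimetric Inequalities in Mathematical Physics*, Annals of Mathematics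
  Studies 27, Princeton 1951, §1.11–§1.12 (capacity of the spherical condenser). [folklore formulas]
-/

noncomputable section

open MeasureTheory Set Filter Topology Metric Real
open scoped ENNReal NNReal InnerProductSpace

namespace Literature.Analysis.FunctionSpaces

/-! ### The profile of the capacitor potential -/

/-- `D(a, b) = a⁻² − b⁻²`, the normalising constant of the capacitor potential of the annulus
`a < r < b` in `ℝ⁴`. [folklore] -/
def annulusCapD (a b : ℝ) : ℝ := 1 / a ^ 2 - 1 / b ^ 2

/-- The clamped radial profile `r ↦ (r̄⁻² − b⁻²)/(a⁻² − b⁻²)`, `r̄ = max a (min r b)`: equal to `1`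
for `r ≤ a`, to `0` for `r ≥ b`, harmonic (in `ℝ⁴`, as a function of `|x| = r`) in between. [folklore] -/
def annulusCapProfile (a b r : ℝ) : ℝ :=
  (1 / (max a (min r b)) ^ 2 - 1 / b ^ 2) / annulusCapD a b

variable {a b : ℝ}

/-- `D(a,b) > 0` for `0 < a < b`. [folklore] -/
theorem annulusCapD_pos (ha : 0 < a) (hab : a < b) : 0 < annulusCapD a b := by
  unfold annulusCapD
  have hb : 0 < b := ha.trans hab
  rw [sub_pos, one_div_lt_one_div (pow_pos hb 2) (pow_pos ha 2)]
  exact pow_lt_pow_left₀ hab ha.le two_ne_zero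

/-- The unclamped profile on `[a, b]`. [folklore] -/
theorem annulusCapProfile_eq_of_mem {r : ℝ} (hr : r ∈ Icc a b) :
    annulusCapProfile a b r = (1 / r ^ 2 - 1 / b ^ 2) / annulusCapD a b := by
  unfold annulusCapProfile
  rw [min_eq_left hr.2, max_eq_right hr.1]

/-- The profile equals `1` to the left of `a`. [folklore] -/
theorem annulusCapProfile_of_le_left {r : ℝ} (hr : r ≤ a) (hD : annulusCapD a b ≠ 0) :
    annulusCapProfile a b r = 1 := by
  unfold annulusCapProfile
  have : max a (min r b) = a := max_eq_left ((min_le_left _ _).trans hr)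
  rw [this]
  exact div_self hD

/-- The profile vanishes to the right of `b`. [folklore] -/
theorem annulusCapProfile_of_right_le {r : ℝ} (hab : a ≤ b) (hr : b ≤ r) :
    annulusCapProfile a b r = 0 := by
  unfold annulusCapProfile
  rw [min_eq_right hr, max_eq_right hab, sub_self, zero_div]

/-- The profile is non-negative. [folklore] -/
theorem annulusCapProfile_nonneg (ha : 0 < a) (hab : a < b) (r : ℝ) :
    0 ≤ annulusCapProfile a b r := by
  unfold annulusCapProfile
  refine div_nonneg ?_ (annulusCapD_pos ha hab).le
  have hc := (⟨le_max_left _ _, max_le hab.le (min_le_right _ _)⟩ : max a (min r b) ∈ Icc a b)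
  have hcpos : 0 < max a (min r b) := ha.trans_le hc.1
  rw [sub_nonneg]
  exact one_div_le_one_div_of_le (pow_pos hcpos 2) (pow_le_pow_left₀ hcpos.le hc.2 2)

/-- The profile is at most `1`. [folklore] -/
theorem annulusCapProfile_le_one (ha : 0 < a) (hab : a < b) (r : ℝ) :
    annulusCapProfile a b r ≤ 1 := by
  unfold annulusCapProfile
  rw [div_le_one (annulusCapD_pos ha hab)]
  unfold annulusCapD
  have hc := (⟨le_max_left _ _, max_le hab.le (min_le_right _ _)⟩ : max a (min r b) ∈ Icc a b)
  gcongr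
  exact hc.1

/-- The profile is Lipschitz with constant `2/(a³ D)`: on `[a, b]` its derivative is
`−2/(r³ D)`, and clamping is `1`-Lipschitz. [folklore] -/
theorem lipschitzWith_annulusCapProfile (ha : 0 < a) (hab : a < b) :
    LipschitzWith (Real.toNNReal (2 / (a ^ 3 * annulusCapD a b))) (annulusCapProfile a b) := by
  have hD := annulusCapD_pos ha hab
  set φ : ℝ → ℝ := fun s ↦ ((s ^ 2)⁻¹ - 1 / b ^ 2) / annulusCapD a b with hφ
  -- `φ` is Lipschitz on `[a, b]`
  have hφ' : ∀ s ∈ Icc a b, HasDerivWithinAt φ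
      ((-(2 * s) / (s ^ 2) ^ 2) / annulusCapD a b) (Icc a b) s := by
    intro s hs
    have hs0 : s ≠ 0 := (ha.trans_le hs.1).ne'
    have h1 : HasDerivAt (fun s : ℝ ↦ s ^ 2) (2 * s) s := by
      simpa using hasDerivAt_pow 2 s
    have h2 := h1.inv (pow_ne_zero 2 hs0)
    have h3 : HasDerivAt (fun s : ℝ ↦ (s ^ 2)⁻¹ - 1 / b ^ 2) (-(2 * s) / (s ^ 2) ^ 2) s :=
      h2.sub_const (1 / b ^ 2)
    exact (h3.div_const (annulusCapD a b)).hasDerivWithinAt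
  have hLip : LipschitzOnWith (Real.toNNReal (2 / (a ^ 3 * annulusCapD a b))) φ (Icc a b) := by
    refine (convex_Icc a b).lipschitzOnWith_of_nnnorm_hasDerivWithin_le hφ' fun s hs ↦ ?_
    have hs0 : 0 < s := ha.trans_le hs.1
    rw [← NNReal.coe_le_coe, coe_nnnorm, Real.norm_eq_abs,
      Real.coe_toNNReal _ (by positivity)]
    have e : (-(2 * s) / (s ^ 2) ^ 2) / annulusCapD a b = -(2 / (s ^ 3 * annulusCapD a b)) := by
      field_simp
    rw [e, abs_neg, abs_of_pos (by positivity)]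
    rw [div_le_div_iff₀ (by positivity) (by positivity)]
    have : a ^ 3 ≤ s ^ 3 := pow_le_pow_left₀ ha.le hs.1 3
    nlinarith
  -- compose with the `1`-Lipschitz clamp
  have hclamp : LipschitzWith 1 fun r : ℝ ↦ max a (min r b) :=
    (LipschitzWith.id.min_const b).const_max a
  refine LipschitzWith.of_dist_le_mul fun x y ↦ ?_
  have hx := (⟨le_max_left _ _, max_le hab.le (min_le_right _ _)⟩ : max a (min x b) ∈ Icc a b)
  have hy := (⟨le_max_left _ _, max_le hab.le (min_le_right _ _)⟩ : max a (min y b) ∈ Icc a b)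
  have e1 : annulusCapProfile a b x = φ (max a (min x b)) := by
    simp only [annulusCapProfile, hφ, one_div]
  have e2 : annulusCapProfile a b y = φ (max a (min y b)) := by
    simp only [annulusCapProfile, hφ, one_div]
  rw [e1, e2]
  calc dist (φ (max a (min x b))) (φ (max a (min y b)))
      ≤ Real.toNNReal (2 / (a ^ 3 * annulusCapD a b)) * dist (max a (min x b)) (max a (min y b)) :=
        hLip.dist_le_mul _ hx _ hy
    _ ≤ Real.toNNReal (2 / (a ^ 3 * annulusCapD a b)) * dist x y := by
        gcongr
        simpa using hclamp.dist_le_mul x y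

/-! ### The radial capacitor potential on `ℝ⁴` -/

/-- **The capacitor potential of the annulus `a < |x| < b` in `ℝ⁴`**: `annulusCapProfile a b |x|`.
[folklore] -/
def annulusCap (a b : ℝ) (x : EuclideanSpace ℝ (Fin 4)) : ℝ := annulusCapProfile a b ‖x‖

/-- The potential equals `1` on `|x| ≤ a`. [folklore] -/
theorem annulusCap_eq_one (hD : annulusCapD a b ≠ 0) {x : EuclideanSpace ℝ (Fin 4)} (hx : ‖x‖ ≤ a) :
    annulusCap a b x = 1 :=
  annulusCapProfile_of_le_left hx hD

/-- The potential vanishes on `|x| ≥ b`. [folklore] -/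
theorem annulusCap_eq_zero (hab : a ≤ b) {x : EuclideanSpace ℝ (Fin 4)} (hx : b ≤ ‖x‖) : annulusCap a b x = 0 :=
  annulusCapProfile_of_right_le hab hx

/-- The potential is non-negative. [folklore] -/
theorem annulusCap_nonneg (ha : 0 < a) (hab : a < b) (x : EuclideanSpace ℝ (Fin 4)) : 0 ≤ annulusCap a b x :=
  annulusCapProfile_nonneg ha hab _

/-- The potential is at most `1`. [folklore] -/
theorem annulusCap_le_one (ha : 0 < a) (hab : a < b) (x : EuclideanSpace ℝ (Fin 4)) : annulusCap a b x ≤ 1 :=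
  annulusCapProfile_le_one ha hab _

/-- The potential is Lipschitz (profile Lipschitz, norm `1`-Lipschitz). [folklore] -/
theorem lipschitzWith_annulusCap (ha : 0 < a) (hab : a < b) :
    LipschitzWith (Real.toNNReal (2 / (a ^ 3 * annulusCapD a b))) (annulusCap a b) := by
  refine LipschitzWith.of_dist_le_mul fun x y ↦ ?_
  calc dist (annulusCap a b x) (annulusCap a b y)
      = dist (annulusCapProfile a b ‖x‖) (annulusCapProfile a b ‖y‖) := rfl
    _ ≤ Real.toNNReal (2 / (a ^ 3 * annulusCapD a b)) * dist ‖x‖ ‖y‖ :=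
        (lipschitzWith_annulusCapProfile ha hab).dist_le_mul _ _
    _ ≤ Real.toNNReal (2 / (a ^ 3 * annulusCapD a b)) * dist x y := by
        gcongr
        rw [Real.dist_eq, dist_eq_norm]
        exact abs_norm_sub_norm_le x y

/-- The potential is continuous. [folklore] -/
theorem continuous_annulusCap (ha : 0 < a) (hab : a < b) : Continuous (annulusCap a b) :=
  (lipschitzWith_annulusCap ha hab).continuous

/-- On the open annulus the potential is `(|x|⁻² − b⁻²)/D`, whose differential is
`−D⁻¹ |x|⁻⁴ · 2⟨x, ·⟩`. [folklore] -/
theorem hasFDerivAt_annulusCap_of_mem (ha : 0 < a) {x : EuclideanSpace ℝ (Fin 4)}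
    (hx : a < ‖x‖ ∧ ‖x‖ < b) :
    HasFDerivAt (annulusCap a b)
      ((annulusCapD a b)⁻¹ • ((-((‖x‖ ^ 2) ^ 2)⁻¹) • ((2 : ℝ) • innerSL ℝ x))) x := by
  have hx0 : ‖x‖ ^ 2 ≠ 0 := pow_ne_zero 2 (ha.trans hx.1).ne'
  -- the formula function
  have h0 : HasFDerivAt (fun y : EuclideanSpace ℝ (Fin 4) ↦ ‖y‖ ^ 2) ((2 : ℝ) • innerSL ℝ x) x :=
    (hasStrictFDerivAt_norm_sq x).hasFDerivAt.congr_fderiv (by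
      rw [← Nat.cast_smul_eq_nsmul ℝ, Nat.cast_ofNat])
  have h1 : HasFDerivAt (fun y : EuclideanSpace ℝ (Fin 4) ↦ (‖y‖ ^ 2)⁻¹) ((-((‖x‖ ^ 2) ^ 2)⁻¹) • ((2 : ℝ) • innerSL ℝ x)) x :=
    (hasDerivAt_inv hx0).comp_hasFDerivAt x h0
  have h2 : HasFDerivAt (fun y : EuclideanSpace ℝ (Fin 4) ↦ ((‖y‖ ^ 2)⁻¹ - 1 / b ^ 2) * (annulusCapD a b)⁻¹)
      ((annulusCapD a b)⁻¹ • ((-((‖x‖ ^ 2) ^ 2)⁻¹) • ((2 : ℝ) • innerSL ℝ x))) x := by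
    have := (h1.sub_const (1 / b ^ 2)).mul_const (annulusCapD a b)⁻¹
    simpa using this
  refine h2.congr_of_eventuallyEq ?_
  -- the two functions agree on the open annulus, a neighbourhood of `x`
  have hopen : IsOpen {y : EuclideanSpace ℝ (Fin 4) | a < ‖y‖ ∧ ‖y‖ < b} :=
    (isOpen_lt continuous_const continuous_norm).inter (isOpen_lt continuous_norm continuous_const)
  filter_upwards [hopen.mem_nhds hx] with y hy
  rw [annulusCap, annulusCapProfile_eq_of_mem ⟨hy.1.le, hy.2.le⟩, div_eq_mul_inv, one_div]

/-- Inside `B(0, a)` the potential is locally constant: zero differential. [folklore] -/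
theorem hasFDerivAt_annulusCap_of_lt (ha : 0 < a) (hab : a < b) {x : EuclideanSpace ℝ (Fin 4)} (hx : ‖x‖ < a) :
    HasFDerivAt (annulusCap a b) (0 : EuclideanSpace ℝ (Fin 4) →L[ℝ] ℝ) x := by
  refine (hasFDerivAt_const (1 : ℝ) x).congr_of_eventuallyEq ?_
  filter_upwards [(isOpen_lt continuous_norm continuous_const).mem_nhds hx] with y hy
  exact annulusCap_eq_one (annulusCapD_pos ha hab).ne' hy.le

/-- Outside `B̄(0, b)` the potential is locally constant: zero differential. [folklore] -/
theorem hasFDerivAt_annulusCap_of_gt (hab : a < b) {x : EuclideanSpace ℝ (Fin 4)} (hx : b < ‖x‖) :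
    HasFDerivAt (annulusCap a b) (0 : EuclideanSpace ℝ (Fin 4) →L[ℝ] ℝ) x := by
  refine (hasFDerivAt_const (0 : ℝ) x).congr_of_eventuallyEq ?_
  filter_upwards [(isOpen_lt continuous_const continuous_norm).mem_nhds hx] with y hy
  exact annulusCap_eq_zero hab.le hy.le

/-- The norm of the differential on the annulus: `2/(D |x|³)`. [folklore] -/
theorem norm_annulusCap_fderiv_formula (ha : 0 < a) (hab : a < b) {x : EuclideanSpace ℝ (Fin 4)} (hx : a < ‖x‖) :
    ‖(annulusCapD a b)⁻¹ • ((-((‖x‖ ^ 2) ^ 2)⁻¹) • ((2 : ℝ) • innerSL ℝ x))‖ =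
      2 / (annulusCapD a b * ‖x‖ ^ 3) := by
  have hD := annulusCapD_pos ha hab
  have hx0 : 0 < ‖x‖ := ha.trans hx
  rw [norm_smul, norm_smul, norm_smul, innerSL_apply_norm, Real.norm_eq_abs, Real.norm_eq_abs,
    Real.norm_eq_abs, abs_inv, abs_of_pos hD, abs_neg, abs_inv, abs_of_pos (by positivity),
    abs_two]
  field_simp

/-- **Differentiability and gradient norm of the capacitor potential off the two spheres**:
`‖D(annulusCap a b)(x)‖ = 𝟙_{(a,b)}(|x|) · 2/(D|x|³)`. [folklore] -/
theorem differentiableAt_annulusCap (ha : 0 < a) (hab : a < b) {x : EuclideanSpace ℝ (Fin 4)} (h1 : ‖x‖ ≠ a)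
    (h2 : ‖x‖ ≠ b) : DifferentiableAt ℝ (annulusCap a b) x := by
  rcases lt_or_gt_of_ne h1 with hlt | hgt
  · exact (hasFDerivAt_annulusCap_of_lt ha hab hlt).differentiableAt
  · rcases lt_or_gt_of_ne h2 with hlt' | hgt'
    · exact (hasFDerivAt_annulusCap_of_mem ha ⟨hgt, hlt'⟩).differentiableAt
    · exact (hasFDerivAt_annulusCap_of_gt hab hgt').differentiableAt

/-- **Gradient norm of the capacitor potential off the two spheres**: `‖D(annulusCap a b)(x)‖ = 𝟙_{(a,b)}(|x|) · 2/(D|x|³)`. [folklore] -/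
theorem norm_fderiv_annulusCap (ha : 0 < a) (hab : a < b) {x : EuclideanSpace ℝ (Fin 4)} (h1 : ‖x‖ ≠ a)
    (h2 : ‖x‖ ≠ b) :
    ‖fderiv ℝ (annulusCap a b) x‖ =
      (Ioo a b).indicator (fun r ↦ 2 / (annulusCapD a b * r ^ 3)) ‖x‖ := by
  rcases lt_or_gt_of_ne h1 with hlt | hgt
  · rw [(hasFDerivAt_annulusCap_of_lt ha hab hlt).fderiv, norm_zero,
      indicator_of_notMem (fun h ↦ lt_asymm h.1 hlt)]
  · rcases lt_or_gt_of_ne h2 with hlt' | hgt'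
    · rw [(hasFDerivAt_annulusCap_of_mem ha ⟨hgt, hlt'⟩).fderiv,
        norm_annulusCap_fderiv_formula ha hab hgt, indicator_of_mem (mem_Ioo.2 ⟨hgt, hlt'⟩)]
    · rw [(hasFDerivAt_annulusCap_of_gt hab hgt').fderiv, norm_zero,
        indicator_of_notMem (fun h ↦ lt_asymm h.2 hgt')]

/-! ### Staircase sums of capacitor potentials -/

/-- **Staircase function**: `∑_{j<N} c_j · annulusCap (R (j+1)) (R j)` for radii
`R 0 > R 1 > ⋯ > R N > 0` — a continuous radial function, constant `∑_{j<N} c_j` on `|x| ≤ R N`,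
zero on `|x| ≥ R 0`, interpolating harmonically on each annulus. [folklore] -/
def stairFun (N : ℕ) (R c : ℕ → ℝ) (x : EuclideanSpace ℝ (Fin 4)) : ℝ :=
  ∑ j ∈ Finset.range N, c j * annulusCap (R (j + 1)) (R j) x

variable {N : ℕ} {R c : ℕ → ℝ}

/-- The staircase is Lipschitz (a finite sum of Lipschitz functions). [folklore] -/
theorem stairFun_lipschitz (hR : StrictAnti R) (hRN : 0 < R N) :
    ∃ K : ℝ≥0, LipschitzWith K (stairFun N R c) := by
  induction N with
  | zero => exact ⟨0, by simp [stairFun]⟩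
  | succ n ih =>
    have hRn : 0 < R n := hRN.trans (hR (Nat.lt_succ_self n))
    obtain ⟨K, hK⟩ := ih hRn
    refine ⟨K + ‖c n‖₊ * Real.toNNReal (2 / (R (n + 1) ^ 3 * annulusCapD (R (n + 1)) (R n))), ?_⟩
    have h2 : LipschitzWith (‖c n‖₊ * Real.toNNReal (2 / (R (n + 1) ^ 3 *
        annulusCapD (R (n + 1)) (R n)))) fun x ↦ c n * annulusCap (R (n + 1)) (R n) x :=
      (lipschitzWith_smul (c n)).comp (lipschitzWith_annulusCap hRN (hR (Nat.lt_succ_self n)))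
    have : stairFun (n + 1) R c = fun x ↦ stairFun n R c x + c n * annulusCap (R (n + 1)) (R n) x := by
      funext x
      simp [stairFun, Finset.sum_range_succ]
    rw [this]
    exact hK.add h2

/-- The staircase is continuous. [folklore] -/
theorem continuous_stairFun (hR : StrictAnti R) (hRN : 0 < R N) : Continuous (stairFun N R c) := by
  obtain ⟨K, hK⟩ := stairFun_lipschitz (c := c) hR hRN
  exact hK.continuous

/-- Outside `B(0, R 0)` the staircase vanishes. [folklore] -/
theorem stairFun_eq_zero (hR : StrictAnti R) {x : EuclideanSpace ℝ (Fin 4)} (hx : R 0 ≤ ‖x‖) : stairFun N R c x = 0 := by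
  unfold stairFun
  refine Finset.sum_eq_zero fun j hj ↦ ?_
  have hj0 : R j ≤ R 0 := hR.antitone (Nat.zero_le j)
  rw [annulusCap_eq_zero (hR (Nat.lt_succ_self j)).le (hj0.trans hx), mul_zero]

/-- Inside `B̄(0, R N)` the staircase is the full sum `∑_{j<N} c_j`. [folklore] -/
theorem stairFun_eq_sum (hR : StrictAnti R) (hRN : 0 < R N) {x : EuclideanSpace ℝ (Fin 4)} (hx : ‖x‖ ≤ R N) :
    stairFun N R c x = ∑ j ∈ Finset.range N, c j := by
  unfold stairFun
  refine Finset.sum_congr rfl fun j hj ↦ ?_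
  have hj : j + 1 ≤ N := Finset.mem_range.1 hj
  have h1 : R N ≤ R (j + 1) := hR.antitone hj
  have hpos : 0 < R (j + 1) := hRN.trans_le h1
  rw [annulusCap_eq_one (annulusCapD_pos hpos (hR (Nat.lt_succ_self j))).ne' (hx.trans h1), mul_one]

/-- **Value on the `i`-th closed annulus**: for `R (i+1) ≤ |x| ≤ R i`, `i < N`,
`stairFun x = ∑_{j<i} c_j + c_i · annulusCap (R (i+1)) (R i) x`. [folklore] -/
theorem stairFun_eq_of_mem (hR : StrictAnti R) (hRN : 0 < R N) {i : ℕ} (hi : i < N) {x : EuclideanSpace ℝ (Fin 4)}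
    (hx : R (i + 1) ≤ ‖x‖ ∧ ‖x‖ ≤ R i) :
    stairFun N R c x = (∑ j ∈ Finset.range i, c j) + c i * annulusCap (R (i + 1)) (R i) x := by
  unfold stairFun
  rw [← Finset.sum_range_add_sum_Ico _ (Nat.succ_le_of_lt hi), Finset.sum_range_succ]
  have htail : ∑ j ∈ Finset.Ico (i + 1) N, c j * annulusCap (R (j + 1)) (R j) x = 0 := by
    refine Finset.sum_eq_zero fun j hj ↦ ?_
    have hij : i + 1 ≤ j := (Finset.mem_Ico.1 hj).1
    have : R j ≤ R (i + 1) := hR.antitone hij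
    rw [annulusCap_eq_zero (hR (Nat.lt_succ_self j)).le (this.trans hx.1), mul_zero]
  have hhead : ∑ j ∈ Finset.range i, c j * annulusCap (R (j + 1)) (R j) x =
      ∑ j ∈ Finset.range i, c j := by
    refine Finset.sum_congr rfl fun j hj ↦ ?_
    have hji : j + 1 ≤ i := Finset.mem_range.1 hj
    have h1 : R i ≤ R (j + 1) := hR.antitone hji
    have hpos : 0 < R (j + 1) :=
      hRN.trans_le (hR.antitone ((hji.trans hi.le)))
    rw [annulusCap_eq_one (annulusCapD_pos hpos (hR (Nat.lt_succ_self j))).ne' (hx.2.trans h1),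
      mul_one]
  rw [htail, hhead, add_zero]

/-- On the `i`-th closed annulus the staircase lies between the partial sums `∑_{j<i} c_j` and
`∑_{j≤i} c_j` (`c ≥ 0`). [folklore] -/
theorem stairFun_mem_Icc (hR : StrictAnti R) (hRN : 0 < R N) (hc : ∀ j, 0 ≤ c j) {i : ℕ}
    (hi : i < N) {x : EuclideanSpace ℝ (Fin 4)} (hx : R (i + 1) ≤ ‖x‖ ∧ ‖x‖ ≤ R i) :
    stairFun N R c x ∈ Icc (∑ j ∈ Finset.range i, c j) (∑ j ∈ Finset.range (i + 1), c j) := by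
  have hpos : 0 < R (i + 1) := hRN.trans_le (hR.antitone (Nat.succ_le_of_lt hi))
  have hab : R (i + 1) < R i := hR (Nat.lt_succ_self i)
  rw [stairFun_eq_of_mem hR hRN hi hx, Finset.sum_range_succ]
  constructor
  · simpa using mul_nonneg (hc i) (annulusCap_nonneg hpos hab x)
  · simpa using mul_le_of_le_one_right (hc i) (annulusCap_le_one hpos hab x)

/-- The staircase is non-negative for `c ≥ 0`. [folklore] -/
theorem stairFun_nonneg (hR : StrictAnti R) (hRN : 0 < R N) (hc : ∀ j, 0 ≤ c j) (x : EuclideanSpace ℝ (Fin 4)) :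
    0 ≤ stairFun N R c x := by
  unfold stairFun
  refine Finset.sum_nonneg fun j hj ↦ mul_nonneg (hc j) ?_
  have hjN : j + 1 ≤ N := Finset.mem_range.1 hj
  exact annulusCap_nonneg (hRN.trans_le (hR.antitone hjN)) (hR (Nat.lt_succ_self j)) x

/-- The staircase is at most `∑_{j<N} c_j` for `c ≥ 0`. [folklore] -/
theorem stairFun_le_sum (hR : StrictAnti R) (hRN : 0 < R N) (hc : ∀ j, 0 ≤ c j) (x : EuclideanSpace ℝ (Fin 4)) :
    stairFun N R c x ≤ ∑ j ∈ Finset.range N, c j := by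
  unfold stairFun
  refine Finset.sum_le_sum fun j hj ↦ ?_
  have hjN : j + 1 ≤ N := Finset.mem_range.1 hj
  exact mul_le_of_le_one_right (hc j)
    (annulusCap_le_one (hRN.trans_le (hR.antitone hjN)) (hR (Nat.lt_succ_self j)) x)

/-- The staircase has compact support (in `B̄(0, R 0)`). [folklore] -/
theorem hasCompactSupport_stairFun (hR : StrictAnti R) : HasCompactSupport (stairFun N R c) := by
  refine HasCompactSupport.intro (isCompact_closedBall (0 : EuclideanSpace ℝ (Fin 4)) (R 0)) fun x hx ↦ ?_
  rw [mem_closedBall, dist_zero_right, not_le] at hx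
  exact stairFun_eq_zero hR hx.le

/-! ### The gradient of the staircase and its energy -/

/-- The squared gradient profile: `∑_{j<N} 𝟙_{(R(j+1), R j)}(r) · c_j² (2/(D_j r³))²`. [folklore] -/
def stairGradSq (N : ℕ) (R c : ℕ → ℝ) (r : ℝ) : ℝ :=
  ∑ j ∈ Finset.range N, (Ioo (R (j + 1)) (R j)).indicator
    (fun r ↦ c j ^ 2 * (2 / (annulusCapD (R (j + 1)) (R j) * r ^ 3)) ^ 2) r

/-- The squared gradient profile is non-negative. [folklore] -/
theorem stairGradSq_nonneg (r : ℝ) : 0 ≤ stairGradSq N R c r := by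
  unfold stairGradSq
  refine Finset.sum_nonneg fun j _ ↦ ?_
  by_cases h : r ∈ Ioo (R (j + 1)) (R j)
  · rw [indicator_of_mem h]; positivity
  · rw [indicator_of_notMem h]

/-- **Off the spheres `|x| = R j` the staircase is differentiable and
`‖D(stairFun)(x)‖² = stairGradSq |x|`** (at most one annulus contributes). [folklore] -/
theorem norm_fderiv_stairFun_sq (hR : StrictAnti R) (hRN : 0 < R N) {x : EuclideanSpace ℝ (Fin 4)}
    (hx : ∀ j ≤ N, ‖x‖ ≠ R j) :
    DifferentiableAt ℝ (stairFun N R c) x ∧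
      ‖fderiv ℝ (stairFun N R c) x‖ ^ 2 = stairGradSq N R c ‖x‖ := by
  -- each summand is differentiable at `x`
  have hdiff : ∀ j ∈ Finset.range N, DifferentiableAt ℝ
      (fun y ↦ c j * annulusCap (R (j + 1)) (R j) y) x := by
    intro j hj
    have hjN : j + 1 ≤ N := Finset.mem_range.1 hj
    exact (differentiableAt_annulusCap (hRN.trans_le (hR.antitone hjN)) (hR (Nat.lt_succ_self j))
      (hx _ hjN) (hx _ ((Nat.le_succ j).trans hjN))).const_mul _
  have hsum : stairFun N R c = fun y ↦ ∑ j ∈ Finset.range N, c j * annulusCap (R (j + 1)) (R j) y :=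
    rfl
  have hD : DifferentiableAt ℝ (stairFun N R c) x := by
    rw [hsum]
    exact DifferentiableAt.fun_sum hdiff
  refine ⟨hD, ?_⟩
  have hfd : fderiv ℝ (stairFun N R c) x =
      ∑ j ∈ Finset.range N, c j • fderiv ℝ (annulusCap (R (j + 1)) (R j)) x := by
    rw [hsum, fderiv_fun_sum hdiff]
    refine Finset.sum_congr rfl fun j hj ↦ ?_
    have hjN : j + 1 ≤ N := Finset.mem_range.1 hj
    exact fderiv_const_mul (differentiableAt_annulusCap (hRN.trans_le (hR.antitone hjN))
      (hR (Nat.lt_succ_self j)) (hx _ hjN) (hx _ ((Nat.le_succ j).trans hjN))) _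
  -- norms of the summands
  have hnorm : ∀ j ∈ Finset.range N, ‖fderiv ℝ (annulusCap (R (j + 1)) (R j)) x‖ =
      (Ioo (R (j + 1)) (R j)).indicator
        (fun r ↦ 2 / (annulusCapD (R (j + 1)) (R j) * r ^ 3)) ‖x‖ := by
    intro j hj
    have hjN : j + 1 ≤ N := Finset.mem_range.1 hj
    exact norm_fderiv_annulusCap (hRN.trans_le (hR.antitone hjN)) (hR (Nat.lt_succ_self j))
      (hx _ hjN) (hx _ ((Nat.le_succ j).trans hjN))
  rw [hfd]
  by_cases hmem : ∃ i ∈ Finset.range N, ‖x‖ ∈ Ioo (R (i + 1)) (R i)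
  · obtain ⟨i, hi, hxi⟩ := hmem
    -- only the `i`-th terms survive
    have hother : ∀ j ∈ Finset.range N, j ≠ i → ‖x‖ ∉ Ioo (R (j + 1)) (R j) := by
      intro j _ hji hxj
      rcases lt_or_gt_of_ne hji with h | h
      · have : R i ≤ R (j + 1) := hR.antitone (Nat.succ_le_of_lt h)
        exact absurd (hxj.1.trans_le' (this.trans' hxi.2.le)) (lt_irrefl _)
      · have : R j ≤ R (i + 1) := hR.antitone (Nat.succ_le_of_lt h)
        exact absurd (hxi.1.trans_le' (this.trans' hxj.2.le)) (lt_irrefl _)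
    have hzero : ∀ j ∈ Finset.range N, j ≠ i → fderiv ℝ (annulusCap (R (j + 1)) (R j)) x = 0 := by
      intro j hj hji
      rw [← norm_eq_zero, hnorm j hj, indicator_of_notMem (hother j hj hji)]
    rw [Finset.sum_eq_single i (fun j hj hji ↦ by rw [hzero j hj hji, smul_zero])
      (fun h ↦ absurd hi h), norm_smul, mul_pow, Real.norm_eq_abs, sq_abs, hnorm i hi,
      indicator_of_mem hxi]
    unfold stairGradSq
    rw [Finset.sum_eq_single i (fun j hj hji ↦ by rw [indicator_of_notMem (hother j hj hji)])
      (fun h ↦ absurd hi h), indicator_of_mem hxi]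
  · push Not at hmem
    have hzero : ∀ j ∈ Finset.range N, fderiv ℝ (annulusCap (R (j + 1)) (R j)) x = 0 := by
      intro j hj
      rw [← norm_eq_zero, hnorm j hj, indicator_of_notMem (hmem j hj)]
    rw [Finset.sum_eq_zero (fun j hj ↦ by rw [hzero j hj, smul_zero]), norm_zero]
    unfold stairGradSq
    rw [Finset.sum_eq_zero (fun j hj ↦ by rw [indicator_of_notMem (hmem j hj)])]
    ring

/-- The gradient norm of the staircase is radial off the spheres: for a.e. `x`,
`‖D(stairFun)(x)‖² = stairGradSq |x|`. [folklore] -/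
theorem norm_fderiv_stairFun_sq_ae (hR : StrictAnti R) (hRN : 0 < R N) :
    (fun x ↦ ‖fderiv ℝ (stairFun N R c) x‖ ^ 2) =ᵐ[volume] fun x ↦ stairGradSq N R c ‖x‖ := by
  have hnull : volume (⋃ j ∈ Finset.range (N + 1), sphere (0 : EuclideanSpace ℝ (Fin 4)) (R j)) = 0 := by
    refine (measure_biUnion_null_iff (Finset.countable_toSet _)).2 fun j _ ↦ ?_
    exact Measure.addHaar_sphere volume 0 (R j)
  refine (ae_iff.2 (measure_mono_null (fun x hx ↦ ?_) hnull))
  simp only [mem_setOf_eq] at hx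
  by_contra hx'
  apply hx
  refine (norm_fderiv_stairFun_sq hR hRN fun j hj heq ↦ hx' ?_).2
  simp only [mem_iUnion, Finset.mem_range, exists_prop]
  exact ⟨j, Nat.lt_succ_of_le hj, by simpa using heq⟩

/-- The one-dimensional integral behind the energy identity:
`∫_{(a,b)} r³ · (2/(D r³))² dr = 2/D` for `0 < a < b`, `D = a⁻² − b⁻²`. [folklore] -/
theorem integral_annulus_energy_profile (ha : 0 < a) (hab : a < b) :
    ∫ r in Ioo a b, r ^ 3 * (2 / (annulusCapD a b * r ^ 3)) ^ 2 = 2 / annulusCapD a b := by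
  have hD := annulusCapD_pos ha hab
  have hb : 0 < b := ha.trans hab
  have e1 : ∫ r in Ioo a b, r ^ 3 * (2 / (annulusCapD a b * r ^ 3)) ^ 2 =
      ∫ r in Ioo a b, (4 / annulusCapD a b ^ 2) * r ^ (-3 : ℤ) := by
    refine setIntegral_congr_fun measurableSet_Ioo fun r hr ↦ ?_
    have hr0 : 0 < r := ha.trans hr.1
    rw [zpow_neg, zpow_ofNat]
    field_simp
    ring
  rw [e1, integral_const_mul, ← integral_Ioc_eq_integral_Ioo, ← intervalIntegral.integral_of_le hab.le,
    integral_zpow (Or.inr ⟨by norm_num, by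
      rw [Set.uIcc_of_le hab.le]
      exact fun h ↦ (lt_irrefl (0 : ℝ)) (ha.trans_le h.1)⟩)]
  have e2 : ((-3 : ℤ) + 1 : ℤ) = -2 := by norm_num
  simp only [e2, show ((-3 : ℤ) : ℝ) + 1 = -2 by norm_num]
  have key : b ^ (-2 : ℤ) - a ^ (-2 : ℤ) = -annulusCapD a b := by
    unfold annulusCapD
    rw [zpow_neg, zpow_neg, zpow_ofNat, zpow_ofNat, one_div, one_div]
    ring
  rw [key]
  field_simp
  ring

/-- `|B(0,1)| = π²/2` in `ℝ⁴` (real-valued). [folklore] -/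
theorem volume_real_ball_zero_one_four : volume.real (ball (0 : EuclideanSpace ℝ (Fin 4)) 1) = Real.pi ^ 2 / 2 := by
  rw [Measure.real, EuclideanSpace.volume_ball, Fintype.card_fin, ENNReal.toReal_mul,
    ENNReal.toReal_pow, ENNReal.toReal_ofReal zero_le_one, one_pow, one_mul]
  have hG : Real.Gamma ((4 : ℕ) / 2 + 1 : ℝ) = 2 := by
    rw [show ((4 : ℕ) / 2 + 1 : ℝ) = (2 : ℕ) + 1 by norm_num, Real.Gamma_nat_eq_factorial]
    norm_num [Nat.factorial]
  have hs : Real.sqrt Real.pi ^ (4 : ℕ) = Real.pi ^ 2 := by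
    rw [show (4 : ℕ) = 2 * 2 from rfl, pow_mul, Real.sq_sqrt Real.pi_pos.le]
  rw [hG, hs, ENNReal.toReal_ofReal (by positivity)]

/-- **Energy identity for the staircase**:
`∫ ‖D(stairFun)‖² dx = ∑_{j<N} 4π² c_j² / (R(j+1)⁻² − R(j)⁻²)` — polar coordinates and
`∫_{R(j+1)}^{R j} r³ (2/(D_j r³))² dr = 2/D_j`. [folklore] -/
theorem integral_norm_fderiv_stairFun_sq (hR : StrictAnti R) (hRN : 0 < R N) :
    ∫ x, ‖fderiv ℝ (stairFun N R c) x‖ ^ 2 =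
      ∑ j ∈ Finset.range N, 4 * Real.pi ^ 2 * c j ^ 2 / annulusCapD (R (j + 1)) (R j) := by
  rw [integral_congr_ae (norm_fderiv_stairFun_sq_ae (c := c) hR hRN),
    integral_fun_norm_addHaar volume (stairGradSq N R c), finrank_euclideanSpace_fin,
    volume_real_ball_zero_one_four]
  -- the radial integrand of the `j`-th term, as an indicator
  have heq : ∀ j, (fun y : ℝ ↦ y ^ (4 - 1) • (Ioo (R (j + 1)) (R j)).indicator
      (fun r ↦ c j ^ 2 * (2 / (annulusCapD (R (j + 1)) (R j) * r ^ 3)) ^ 2) y) =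
      (Ioo (R (j + 1)) (R j)).indicator fun r ↦
        r ^ 3 * (c j ^ 2 * (2 / (annulusCapD (R (j + 1)) (R j) * r ^ 3)) ^ 2) := by
    intro j
    funext y
    by_cases hy : y ∈ Ioo (R (j + 1)) (R j)
    · rw [indicator_of_mem hy, indicator_of_mem hy, smul_eq_mul]
    · rw [indicator_of_notMem hy, indicator_of_notMem hy, smul_zero]
  -- integrability of each term on `(0, ∞)`
  have hterm : ∀ j ∈ Finset.range N, IntegrableOn (fun y : ℝ ↦ y ^ (4 - 1) •
      (Ioo (R (j + 1)) (R j)).indicator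
        (fun r ↦ c j ^ 2 * (2 / (annulusCapD (R (j + 1)) (R j) * r ^ 3)) ^ 2) y) (Ioi 0) := by
    intro j hj
    have hjN : j + 1 ≤ N := Finset.mem_range.1 hj
    have ha : 0 < R (j + 1) := hRN.trans_le (hR.antitone hjN)
    have hab : R (j + 1) < R j := hR (Nat.lt_succ_self j)
    rw [heq j, integrableOn_indicator_iff measurableSet_Ioo]
    have hcont : ContinuousOn (fun r : ℝ ↦
        r ^ 3 * (c j ^ 2 * (2 / (annulusCapD (R (j + 1)) (R j) * r ^ 3)) ^ 2))
        (Icc (R (j + 1)) (R j)) := by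
      refine ContinuousOn.mul (continuousOn_pow 3) (ContinuousOn.mul continuousOn_const ?_)
      refine ContinuousOn.pow (ContinuousOn.div continuousOn_const
        (continuousOn_const.mul (continuousOn_pow 3)) fun r hr ↦ ?_) 2
      exact mul_ne_zero (annulusCapD_pos ha hab).ne' (pow_ne_zero 3 (ha.trans_le hr.1).ne')
    have hint : IntegrableOn (fun r : ℝ ↦
        r ^ 3 * (c j ^ 2 * (2 / (annulusCapD (R (j + 1)) (R j) * r ^ 3)) ^ 2))
        (Ioo (R (j + 1)) (R j)) :=
      (hcont.integrableOn_compact isCompact_Icc).mono_set Ioo_subset_Icc_self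
    exact hint.mono_set inter_subset_left
  -- the value of each term
  have hval : ∀ j ∈ Finset.range N, ∫ y in Ioi (0 : ℝ), y ^ (4 - 1) •
      (Ioo (R (j + 1)) (R j)).indicator
        (fun r ↦ c j ^ 2 * (2 / (annulusCapD (R (j + 1)) (R j) * r ^ 3)) ^ 2) y =
      c j ^ 2 * (2 / annulusCapD (R (j + 1)) (R j)) := by
    intro j hj
    have hjN : j + 1 ≤ N := Finset.mem_range.1 hj
    have ha : 0 < R (j + 1) := hRN.trans_le (hR.antitone hjN)
    have hab : R (j + 1) < R j := hR (Nat.lt_succ_self j)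
    have hsub : Ioo (R (j + 1)) (R j) ⊆ Ioi 0 := fun r hr ↦ ha.trans hr.1
    rw [show (fun y : ℝ ↦ y ^ (4 - 1) • (Ioo (R (j + 1)) (R j)).indicator
      (fun r ↦ c j ^ 2 * (2 / (annulusCapD (R (j + 1)) (R j) * r ^ 3)) ^ 2) y) = _ from heq j,
      setIntegral_indicator measurableSet_Ioo, inter_eq_right.2 hsub,
      ← integral_annulus_energy_profile ha hab, ← integral_const_mul]
    refine setIntegral_congr_fun measurableSet_Ioo fun r _ ↦ ?_
    ring
  have hsplit : (fun y : ℝ ↦ y ^ (4 - 1) • stairGradSq N R c y) = fun y ↦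
      ∑ j ∈ Finset.range N, y ^ (4 - 1) • (Ioo (R (j + 1)) (R j)).indicator
        (fun r ↦ c j ^ 2 * (2 / (annulusCapD (R (j + 1)) (R j) * r ^ 3)) ^ 2) y := by
    funext y
    simp only [stairGradSq, Finset.smul_sum]
  rw [hsplit, integral_finsetSum _ hterm, Finset.sum_congr rfl hval, nsmul_eq_mul, smul_eq_mul,
    Finset.mul_sum, Finset.mul_sum]
  refine Finset.sum_congr rfl fun j _ ↦ ?_
  push_cast
  ring

end Literature.Analysis.FunctionSpaces

end
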